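import Summits.QuantumFields.YangMills.Theorems.AtomicCalibrationRGridPartition
import Summits.QuantumFields.YangMills.Theorems.AtomicCalibrationRProductBump
import Summits.QuantumFields.YangMills.Theorems.AtomicCalibrationRPairCutoffProduct
import Summits.QuantumFields.YangMills.Theorems.AtomicCalibrationRTelescopingAssembly

/-!
# AtomicCalibrationR (stmt-QuantumFields-28169), E2 `stub_offDiagonalWhitney` — rates of the band bumps of construction (T)
# (construction (T) of the E2 helper note, evidence #19 on 28169; prover w4 g22, free hands)

The bump part of a piece of construction (T) is `b_{k,c} := (pairCut (k+1) − pairCut k) · gridBump φ n h c` (band `k+1`) or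
`pairCut 0 · gridBump φ n h c` (far part).  This file turns the landed ingredient rates into the rate of `b`:

* `profile_abs_le_one`, `exists_profile_deriv_bounds` — a periodic-partition profile (`0 ≤ φ`, `tsupport φ ⊆ [-1,1]`,
  `Σ_c φ(t−c) = 1`, `C^∞`) has `|φ| ≤ 1` and bounded derivatives of every order;
* `exists_gridBump_rate` — `∃ A ≥ 0`, `‖D^m (gridBump φ n h c) z‖ ≤ (A·4n/h)^m` (`m ≤ N'`, `0 < h ≤ 1`) — `ProductBump` restated for
  `GridPartition.gridBump`;
* `norm_iteratedFDeriv_bandBump_le` — `‖D^j ((pairCut (k+1) − pairCut k)·gridBump) z‖ ≤ (2C'n²2^{k+1} + A·4n/h)^j`;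
  `norm_iteratedFDeriv_farBump_le` — `‖D^j (pairCut 0 · gridBump) z‖ ≤ (C'n² + A·4n/h)^j` (`j ≤ N'`, `n ≥ 1`, `C'` from
  `PairCutoffProduct.exists_pairCut_rate`).

All rates are of the E0′-admissible form `(c · poly(n) / h_k)^j` once `h = h_k ≍ 2^{−k}/Λ`.  No stub/crux/rung/summit is closed;
nothing here touches Yang–Mills; the YM mass gap is NOT proved. [folklore]
-/

set_option autoImplicit false

noncomputable section

open scoped BigOperators ContDiff
open Set
open Summit.QuantumFields.YangMills.Cruxes.AtomicCalibrationR.GridPartition (gridBump contDiff_gridBump profile_eq_zero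
  sum_Icc_profile_eq_one)
open Summit.QuantumFields.YangMills.Cruxes.AtomicCalibrationR.ProductBump (norm_iteratedFDeriv_gridBump_le)
open Summit.QuantumFields.YangMills.Cruxes.AtomicCalibrationR.PairCutoff (pairCut contDiff_pairCut pairCut_nonneg pairCut_le_one)
open Summit.QuantumFields.YangMills.Cruxes.AtomicCalibrationR.TelescopingAssembly (norm_iteratedFDeriv_mul_le_add_pow
  norm_iteratedFDeriv_sub_le_pow)

namespace Summit.QuantumFields.YangMills.Cruxes.AtomicCalibrationR.BandBump

/-! ## The profile -/

/-- A non-negative profile with `Σ_c φ(t − c) = 1` and `tsupport φ ⊆ [-1,1]` satisfies `|φ| ≤ 1`. -/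
theorem profile_abs_le_one {φ : ℝ → ℝ} (hφs : tsupport φ ⊆ Icc (-1 : ℝ) 1) (hφ0 : ∀ t, 0 ≤ φ t)
    (hφ1 : ∀ t, ∑' j : ℤ, φ (t - j) = 1) (t : ℝ) : |φ t| ≤ 1 := by
  rw [abs_of_nonneg (hφ0 t)]
  by_cases ht : 1 < |t|
  · rw [profile_eq_zero hφs ht]; exact zero_le_one
  · rw [not_lt] at ht
    have ht' := abs_le.1 ht
    have hmem : (0 : ℤ) ∈ Finset.Icc (⌊t⌋ - 1) (⌈t⌉ + 1) := by
      rw [Finset.mem_Icc]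
      constructor
      · have h1 : ⌊t⌋ ≤ 1 := Int.floor_le_iff.2 (by push_cast; linarith)
        omega
      · have h1 : (-2 : ℤ) < ⌈t⌉ := Int.lt_ceil.2 (by push_cast; linarith)
        omega
    have hle : φ (t - ((0 : ℤ) : ℝ)) ≤ ∑ j ∈ Finset.Icc (⌊t⌋ - 1) (⌈t⌉ + 1), φ (t - j) :=
      Finset.single_le_sum (f := fun j : ℤ => φ (t - j)) (fun j _ => hφ0 _) hmem
    rw [sum_Icc_profile_eq_one hφs hφ1 t] at hle
    simpa using hle

/-- A `C^∞` profile with `tsupport φ ⊆ [-1,1]` has bounded derivatives of every order. -/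
theorem exists_profile_deriv_bounds {φ : ℝ → ℝ} (hφ : ContDiff ℝ ∞ φ) (hφs : tsupport φ ⊆ Icc (-1 : ℝ) 1) :
    ∃ D : ℕ → ℝ, ∀ (j : ℕ) (t : ℝ), ‖iteratedFDeriv ℝ j φ t‖ ≤ D j := by
  have hc : HasCompactSupport φ := IsCompact.of_isClosed_subset isCompact_Icc (isClosed_tsupport _) hφs
  have h : ∀ j : ℕ, ∃ Dj : ℝ, ∀ t : ℝ, ‖iteratedFDeriv ℝ j φ t‖ ≤ Dj := fun j =>
    (hφ.continuous_iteratedFDeriv (by exact_mod_cast le_top)).bounded_above_of_compact_support (hc.iteratedFDeriv j)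
  choose D hD using h
  exact ⟨D, hD⟩

/-! ## Rates of the grid bumps (restated for `gridBump`) -/

/-- `∃ A ≥ 0` with `‖D^m (gridBump φ n h c) z‖ ≤ (A·4n/h)^m` for `m ≤ N'`, `0 < h ≤ 1`, all `n, c, z`. -/
theorem exists_gridBump_rate {φ : ℝ → ℝ} (hφ : ContDiff ℝ ∞ φ) (hφs : tsupport φ ⊆ Icc (-1 : ℝ) 1) (hφ0 : ∀ t, 0 ≤ φ t)
    (hφ1 : ∀ t, ∑' j : ℤ, φ (t - j) = 1) (N' : ℕ) :
    ∃ A : ℝ, 0 ≤ A ∧ ∀ (n : ℕ) (h : ℝ), 0 < h → h ≤ 1 → ∀ (c : Fin n × Fin 4 → ℤ) (m : ℕ), m ≤ N' →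
      ∀ z : Fin n → EuclideanSpace ℝ (Fin 4), ‖iteratedFDeriv ℝ m (gridBump φ n h c) z‖ ≤ (A * (4 * n) / h) ^ m := by
  obtain ⟨D, hD⟩ := exists_profile_deriv_bounds hφ hφs
  obtain ⟨A, hA0, hA⟩ := norm_iteratedFDeriv_gridBump_le φ hφ (profile_abs_le_one hφs hφ0 hφ1) hD N'
  refine ⟨A, hA0, fun n h hh hh1 c m hm z => ?_⟩
  have h1 := hA n h hh hh1 (fun l i => c (l, i)) m hm z
  have hfun : gridBump φ n h c = fun z : Fin n → EuclideanSpace ℝ (Fin 4) =>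
      ∏ p : Fin n × Fin 4, φ (z p.1 p.2 / h - ((fun l i => c (l, i)) p.1 p.2 : ℤ)) := by
    funext z; rfl
  rw [hfun, div_pow]
  exact h1

/-! ## Rates of the band bumps -/

variable {n : ℕ}

/-- **Band bump rate.**  With `C'` a `pairCut` rate constant (`‖D^i pairCut n k z‖ ≤ (C' n² 2^k)^i`, `i ≤ N'`, `C' ≥ 1`) and `A` a
grid-bump rate constant: for `n ≥ 1`, `0 < h ≤ 1`, `j ≤ N'`,
`‖D^j ((pairCut (k+1) − pairCut k) · gridBump φ n h c) z‖ ≤ (2 C' n² 2^{k+1} + A·4n/h)^j`. [folklore] -/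
theorem norm_iteratedFDeriv_bandBump_le {φ : ℝ → ℝ} (hφ : ContDiff ℝ ∞ φ) {N' : ℕ} {C' A : ℝ} (hC' : 1 ≤ C')
    (hrate : ∀ (n k i : ℕ), i ≤ N' → ∀ z : Fin n → EuclideanSpace ℝ (Fin 4),
      ‖iteratedFDeriv ℝ i (pairCut n k) z‖ ≤ (C' * (n : ℝ) ^ 2 * (2 : ℝ) ^ k) ^ i)
    (hgrid : ∀ (n : ℕ) (h : ℝ), 0 < h → h ≤ 1 → ∀ (c : Fin n × Fin 4 → ℤ) (m : ℕ), m ≤ N' →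
      ∀ z : Fin n → EuclideanSpace ℝ (Fin 4), ‖iteratedFDeriv ℝ m (gridBump φ n h c) z‖ ≤ (A * (4 * n) / h) ^ m)
    (hn : 1 ≤ n) {h : ℝ} (hh : 0 < h) (hh1 : h ≤ 1) (k : ℕ) (c : Fin n × Fin 4 → ℤ) {j : ℕ} (hj : j ≤ N')
    (z : Fin n → EuclideanSpace ℝ (Fin 4)) :
    ‖iteratedFDeriv ℝ j (fun z => (pairCut n (k + 1) z - pairCut n k z) * gridBump φ n h c z) z‖ ≤
      (2 * (C' * (n : ℝ) ^ 2 * (2 : ℝ) ^ (k + 1)) + A * (4 * n) / h) ^ j := by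
  have hC'0 : 0 ≤ C' := by linarith
  have hM : 1 ≤ C' * (n : ℝ) ^ 2 * (2 : ℝ) ^ (k + 1) := by
    have hn' : (1 : ℝ) ≤ (n : ℝ) ^ 2 := one_le_pow₀ (by exact_mod_cast hn)
    have h2 : (1 : ℝ) ≤ (2 : ℝ) ^ (k + 1) := one_le_pow₀ (by norm_num)
    calc (1 : ℝ) = 1 * 1 * 1 := by ring
      _ ≤ C' * (n : ℝ) ^ 2 * (2 : ℝ) ^ (k + 1) :=
          mul_le_mul (mul_le_mul hC' hn' zero_le_one hC'0) h2 zero_le_one (mul_nonneg hC'0 (by positivity))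
  -- rates of the difference: `(2M)^i`
  have hsub : ∀ i : ℕ, i ≤ j → ‖iteratedFDeriv ℝ i (fun z => pairCut n (k + 1) z - pairCut n k z) z‖ ≤
      (2 * (C' * (n : ℝ) ^ 2 * (2 : ℝ) ^ (k + 1))) ^ i := by
    refine norm_iteratedFDeriv_sub_le_pow (contDiff_pairCut n (k + 1)) (contDiff_pairCut n k) hM j z ?_ ?_ ?_
    · -- `|pairCut (k+1) z − pairCut k z| ≤ 1`
      rw [Real.norm_eq_abs, abs_le]
      constructor <;> linarith [pairCut_nonneg n (k + 1) z, pairCut_le_one n (k + 1) z, pairCut_nonneg n k z,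
        pairCut_le_one n k z]
    · intro i _ hi
      exact hrate n (k + 1) i (hi.trans hj) z
    · intro i _ hi
      have h0 : 0 ≤ C' * (n : ℝ) ^ 2 * (2 : ℝ) ^ k := mul_nonneg (mul_nonneg hC'0 (by positivity)) (by positivity)
      refine (hrate n k i (hi.trans hj) z).trans (pow_le_pow_left₀ h0 ?_ i)
      calc C' * (n : ℝ) ^ 2 * (2 : ℝ) ^ k ≤ C' * (n : ℝ) ^ 2 * (2 : ℝ) ^ k * 2 := le_mul_of_one_le_right h0 (by norm_num)
        _ = C' * (n : ℝ) ^ 2 * (2 : ℝ) ^ (k + 1) := by rw [pow_succ]; ring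
  have hg : ∀ i : ℕ, i ≤ j → ‖iteratedFDeriv ℝ i (gridBump φ n h c) z‖ ≤ (A * (4 * n) / h) ^ i :=
    fun i hi => hgrid n h hh hh1 c i (hi.trans hj) z
  have hM0 : 0 ≤ 2 * (C' * (n : ℝ) ^ 2 * (2 : ℝ) ^ (k + 1)) := by linarith
  exact norm_iteratedFDeriv_mul_le_add_pow ((contDiff_pairCut n (k + 1)).sub (contDiff_pairCut n k))
    (contDiff_gridBump hφ n h c) hM0 j z hsub hg

/-- **Far bump rate**: `‖D^j (pairCut 0 · gridBump φ n h c) z‖ ≤ (C' n² + A·4n/h)^j` (`j ≤ N'`). -/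
theorem norm_iteratedFDeriv_farBump_le {φ : ℝ → ℝ} (hφ : ContDiff ℝ ∞ φ) {N' : ℕ} {C' A : ℝ} (hC' : 1 ≤ C')
    (hrate : ∀ (n k i : ℕ), i ≤ N' → ∀ z : Fin n → EuclideanSpace ℝ (Fin 4),
      ‖iteratedFDeriv ℝ i (pairCut n k) z‖ ≤ (C' * (n : ℝ) ^ 2 * (2 : ℝ) ^ k) ^ i)
    (hgrid : ∀ (n : ℕ) (h : ℝ), 0 < h → h ≤ 1 → ∀ (c : Fin n × Fin 4 → ℤ) (m : ℕ), m ≤ N' →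
      ∀ z : Fin n → EuclideanSpace ℝ (Fin 4), ‖iteratedFDeriv ℝ m (gridBump φ n h c) z‖ ≤ (A * (4 * n) / h) ^ m)
    {h : ℝ} (hh : 0 < h) (hh1 : h ≤ 1) (c : Fin n × Fin 4 → ℤ) {j : ℕ} (hj : j ≤ N')
    (z : Fin n → EuclideanSpace ℝ (Fin 4)) :
    ‖iteratedFDeriv ℝ j (fun z => pairCut n 0 z * gridBump φ n h c z) z‖ ≤ (C' * (n : ℝ) ^ 2 + A * (4 * n) / h) ^ j := by
  have hf : ∀ i : ℕ, i ≤ j → ‖iteratedFDeriv ℝ i (pairCut n 0) z‖ ≤ (C' * (n : ℝ) ^ 2) ^ i := by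
    intro i hi
    have := hrate n 0 i (hi.trans hj) z
    simpa using this
  have hg : ∀ i : ℕ, i ≤ j → ‖iteratedFDeriv ℝ i (gridBump φ n h c) z‖ ≤ (A * (4 * n) / h) ^ i :=
    fun i hi => hgrid n h hh hh1 c i (hi.trans hj) z
  have h0 : 0 ≤ C' * (n : ℝ) ^ 2 := mul_nonneg (by linarith) (by positivity)
  exact norm_iteratedFDeriv_mul_le_add_pow (contDiff_pairCut n 0) (contDiff_gridBump hφ n h c) h0 j z hf hg

end Summit.QuantumFields.YangMills.Cruxes.AtomicCalibrationR.BandBump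

end
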